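import Summits.QuantumFields.BalabanUV.Beta.GAN24.SymContactFaceJumpBorder

/-!
# `GAN24.SymContactBorderCellLetters` — (B1) at an1's symmetrised tables: THE TIP ∕ ROOT ∕ TIP×GRADIENT CELL LETTERS in envelope form — the sym twin of leaf-03's (E)
# `GAN24.ContactBorderCellLetters` over `SymContactFaceJumpBorder`

NOT IN PRINT — OUR BOOKKEEPING (OWNER `b2b-balaban-gan24-p1` gen 55, 2026-08-28; row G-an2-4 ∕ (CONV-C), TRANSFER-III, the (III′) S-slot (b), born-V contact letters `hCv ∕ hPcV`
of road-P2 M.104 — TABLE HALF at an1's (0.4)-SYMMETRISED border table `symVhSAt ρ` and (0.4) packed first-order kernel `linSym04At ρ L` (the OWNER's memo `HCV-DESIGN-g55.md` §1∕§2):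
a mkroot-style token re-run of the (E) file named below with `vhSAt ρ ↦ symVhSAt ρ`, `linSymAt ↦ linSym04At`, `linKerAt ∕ linCountAt ∕ linAvgAt ↦ symLinKerAt ∕ symLinCountAt ∕ symLinAvgAt`
(an1's `SymAveragingHessianCounts`, d1's `SymmetrisedAxialPotential`), the `q¹`-pairing normalisation `(L^{d+1})⁻¹ ↦ ((d+1)!·L^{d+1})⁻¹` (leaf-02 g55 `SymLinKernelExpansion.tsum_sum_symLinKerAt_mul`)
and the count constant `L^{d+1}·ℓ ↦ (d+1)!·(L^{d+1}·ℓ)` (an1's `abs_symLinCountAt_le`, leaf-01 g90's `SymContactFaceJumpCommutator.sum_abs_symLinCountAt_le`) carried VERBATIM through every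
statement; every TABLE-FREE lemma of the (E) files is consumed BY NAME (not copied), and leaf-01 g90's `SymContactFaceJump ∕ SymContactFaceJumpCommutator` supply the shared sym
count ∕ commutator letters.  [folklore] bookkeeping; 0 `def`, 0 cited fact, 0 `def … : Prop`, 0 sorry; NO estimate of Bałaban's beyond an1's DEFINED kernels.
HONEST FRAMING (cell contract, verbatim): «discharging `BetaPertH` makes Bałaban's UV stability UNCONDITIONAL — a real constructive-QFT result; it is NOT the continuum limit
and NOT the Clay problem.»  HONEST DEPENDENCY (verbatim): «continuum YM on T⁴ ⇐ BetaPertH ∧ nine spine estimates (0/9 proved); BetaPertH ⇐ (D1) ∧ (D4) ∧ CAP+tail; G-an2-4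
gates asym, D1 and NE2/3/4.»  Discharges NO letter of M.104 ∕ of the OWNER's END `CombChargeRowsOfBornContactLetters` (hCv ∕ hPcV stay HYPOTHESES); NEVER «G-an2-4 closed» as
(CONV-C); NOT D1, NOT BetaPertH, NOT continuum, NOT Clay.  2026-08-28; no existing file touched.

## What (same statements as the (E) file under the substitutions above; `Sym…` namespace)
`rootWeight_mul_dz_mul_symLinCountAt_eq_zero`, `abs_tipWeight_mul_dz_staircase_mul_symLinCountAt_le`, `abs_rootWeight_mul_dz_staircase_mul_symLinCountAt_le`, `abs_tipCommutator_dz_le_of_staircase_of_le`, `abs_rootCommutator_dz_le_of_staircase_of_le`, `abs_tipCommutator_le_of_staircase_of_env`, `abs_rootCommutator_le_of_staircase_of_env`, `abs_tipCommutator_dz_le_of_staircase_of_env`, `abs_rootCommutator_dz_le_of_staircase_of_env`.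
-/

noncomputable section

open Finset
open scoped BigOperators
open Literature.MathematicalPhysics.QuantumFieldTheory
open Literature.MathematicalPhysics.QuantumFieldTheory.Balaban1983to89
open Literature.MathematicalPhysics.QuantumFieldTheory.Balaban1983to89.Beta
open AffineAveraging (Form0 Form1 Site box toSite unitVec unitVec_apply dz)
open AveragingContours (blk)


open Summit.QuantumFields.BalabanUV.Beta.LinearGaugeVH (nearBox mem_nearBox)
open Summit.QuantumFields.BalabanUV.Beta.GAN24.SymContactFaceJump (symLinCountAt_eq_zero_of_not_twoBlock abs_dz_mul_symLinCountAt_le)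
open Summit.QuantumFields.BalabanUV.Beta.GAN24.ContactFaceJump (blk_root blk_farRoot)
open Summit.QuantumFields.BalabanUV.Beta.GAN24.ContactFaceJumpStaircase (staircase_split abs_hplus_jump_le)
open Summit.QuantumFields.BalabanUV.Beta.GAN24.SymContactFaceJumpBorder (abs_tipWeight_mul_symLinCountAt_le abs_rootWeight_mul_symLinCountAt_le tipWeight_mul_dz_mul_symLinCountAt_eq_zero tipCommutator_eq_sum rootCommutator_eq_sum abs_tipCommutator_le_of_staircase_of_le abs_rootCommutator_le_of_staircase_of_le)
open Summit.QuantumFields.BalabanUV.Beta.GAN24.ContactFaceJumpBorder (blk_apply_le_blk_add_unitVec_apply)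

open Summit.QuantumFields.BalabanUV.Beta.SymmetrisedAxialPotential (symLinAvgAt)

open Summit.QuantumFields.BalabanUV.Beta.SymAveragingHessianCounts (symLinCountAt symLinKerAt abs_symLinCountAt_le abs_symLinKerAt_le symLinCountAt_eq_zero symLinKerAt_eq_zero)

namespace Summit.QuantumFields.BalabanUV.Beta.GAN24.SymContactBorderCellLetters

variable {d : ℕ}

/-! ## §1 Pointwise: the border ΔΔ letters on the support of `q¹,ρ` -/

section Pointwise

variable {L Lc : ℕ} {r rr : Fin (d + 1) → ℕ}

/-- NOT IN PRINT; OUR BOOKKEEPING.  **THE BORDER ΔΔ IDENTITY, ROOT FORM**: for block-constant `ψ_a = h_a∘blk L`, `ψ_b = h_b∘blk L` and EVERY bond `(b,z)`,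
`(ψ_a(L·y+ρ) − ψ_a z)·(ψ_b(z+e_b) − ψ_b z)·count(b,z) = 0` — interior bond: gradient `0`; upward crossing: base label `y`, root weight `0`; downward crossing excluded. -/
theorem rootWeight_mul_dz_mul_symLinCountAt_eq_zero (hL : 1 ≤ L) (hr : r ∈ box (d + 1) L) {ψa ψb : Site (d + 1) → ℝ} (ha hb : Site (d + 1) → ℝ)
    (hψa : ∀ u, ψa u = ha (blk L u)) (hψb : ∀ u, ψb u = hb (blk L u)) (μ : Fin (d + 1)) (y : Site (d + 1)) (b : Fin (d + 1)) (z : Site (d + 1)) :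
    (ψa ((L : ℤ) • y + toSite r) - ψa z) * (ψb (z + unitVec b) - ψb z) * (symLinCountAt (toSite r) L μ y (b, z) : ℝ) = 0 := by
  simp only [hψa, hψb, blk_root y hr]
  by_cases hq : (blk L z = y ∨ blk L z = y + unitVec μ) ∧ (blk L (z + unitVec b) = y ∨ blk L (z + unitVec b) = y + unitVec μ)
  · obtain ⟨hz | hz, hz' | hz'⟩ := hq
    · rw [hz, hz']; ring
    · rw [hz]; ring
    · -- downward crossing: impossible
      exfalso
      have hmono := blk_apply_le_blk_add_unitVec_apply hL z b μ
      rw [hz, hz', Pi.add_apply, unitVec_apply, if_pos rfl] at hmono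
      omega
    · rw [hz, hz']; ring
  · rw [symLinCountAt_eq_zero_of_not_twoBlock (f := (b, z)) hL hr hq, Int.cast_zero, mul_zero]

/-- NOT IN PRINT; OUR BOOKKEEPING.  **THE TIP WEIGHT OF ONE STAIRCASE TIMES THE GRADIENT OF ANOTHER, ON THE SUPPORT OF `q¹,ρ`** (one step `L = Lc`, box root, EVERY bond `(b,z)`, any pieces):
`|(ψ_a(z+e_b) − ψ_a(Lc·y+ρ+Lc·e_μ))·(ψ_b(z+e_b) − ψ_b z)·count| ≤ (|G_a 0 (z+e_b) − G_a 0 (Lc·y+ρ+Lc·e_μ)|·(|G_b 0 (z+e_b) − G_b 0 z| + J_b) + J_a·|G_b 0 (z+e_b) − G_b 0 z|)·|count|` — the finest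
pieces pair with everything, the coarse jumps `J_a`, `J_b` only with the other function's FINEST piece (leaf-01's `tipWeight_mul_dz_mul_symLinCountAt_eq_zero` kills `J_a·J_b`). -/
theorem abs_tipWeight_mul_dz_staircase_mul_symLinCountAt_le (hLc : 1 ≤ Lc) (hrr : rr ∈ box (d + 1) Lc) (Ga Gb : ℕ → Site (d + 1) → ℝ) (na nb : ℕ)
    {ψa ψb : Site (d + 1) → ℝ} (hψa : ∀ u, ψa u = ∑ s ∈ Finset.range (na + 1), Ga s (blk (Lc ^ s) u))
    (hψb : ∀ u, ψb u = ∑ s ∈ Finset.range (nb + 1), Gb s (blk (Lc ^ s) u))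
    (μ : Fin (d + 1)) (y : Site (d + 1)) (b : Fin (d + 1)) (z : Site (d + 1)) :
    |(ψa (z + unitVec b) - ψa ((Lc : ℤ) • y + toSite rr + (Lc : ℤ) • unitVec μ)) * (ψb (z + unitVec b) - ψb z) * (symLinCountAt (toSite rr) Lc μ y (b, z) : ℝ)|
      ≤ (|Ga 0 (z + unitVec b) - Ga 0 ((Lc : ℤ) • y + toSite rr + (Lc : ℤ) • unitVec μ)|
            * (|Gb 0 (z + unitVec b) - Gb 0 z| + ∑ s ∈ Finset.range nb, |Gb (s + 1) (blk (Lc ^ s) (y + unitVec μ)) - Gb (s + 1) (blk (Lc ^ s) y)|)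
          + (∑ s ∈ Finset.range na, |Ga (s + 1) (blk (Lc ^ s) (y + unitVec μ)) - Ga (s + 1) (blk (Lc ^ s) y)|) * |Gb 0 (z + unitVec b) - Gb 0 z|)
        * |(symLinCountAt (toSite rr) Lc μ y (b, z) : ℝ)| := by
  set q : ℝ := (symLinCountAt (toSite rr) Lc μ y (b, z) : ℝ) with hq
  set hpa : Site (d + 1) → ℝ := fun y' => ∑ s ∈ Finset.range na, Ga (s + 1) (blk (Lc ^ s) y') with hhpa
  set hpb : Site (d + 1) → ℝ := fun y' => ∑ s ∈ Finset.range nb, Gb (s + 1) (blk (Lc ^ s) y') with hhpb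
  have hψa' : ∀ u, ψa u = Ga 0 u + hpa (blk Lc u) := fun u => by rw [hψa, staircase_split]
  have hψb' : ∀ u, ψb u = Gb 0 u + hpb (blk Lc u) := fun u => by rw [hψb, staircase_split]
  set A0 : ℝ := Ga 0 (z + unitVec b) - Ga 0 ((Lc : ℤ) • y + toSite rr + (Lc : ℤ) • unitVec μ) with hA0
  set A1 : ℝ := hpa (blk Lc (z + unitVec b)) - hpa (blk Lc ((Lc : ℤ) • y + toSite rr + (Lc : ℤ) • unitVec μ)) with hA1
  set B0 : ℝ := Gb 0 (z + unitVec b) - Gb 0 z with hB0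
  set B1 : ℝ := hpb (blk Lc (z + unitVec b)) - hpb (blk Lc z) with hB1
  set Ja : ℝ := ∑ s ∈ Finset.range na, |Ga (s + 1) (blk (Lc ^ s) (y + unitVec μ)) - Ga (s + 1) (blk (Lc ^ s) y)| with hJa
  set Jb : ℝ := ∑ s ∈ Finset.range nb, |Gb (s + 1) (blk (Lc ^ s) (y + unitVec μ)) - Gb (s + 1) (blk (Lc ^ s) y)| with hJb
  have e : (ψa (z + unitVec b) - ψa ((Lc : ℤ) • y + toSite rr + (Lc : ℤ) • unitVec μ)) * (ψb (z + unitVec b) - ψb z) * q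
      = A0 * B0 * q + A0 * (B1 * q) + B0 * (A1 * q) + A1 * B1 * q := by
    simp only [hψa', hψb', hA0, hA1, hB0, hB1]; ring
  have h11 : A1 * B1 * q = 0 :=
    tipWeight_mul_dz_mul_symLinCountAt_eq_zero hLc hrr (ψa := fun u => hpa (blk Lc u)) (ψb := fun u => hpb (blk Lc u)) hpa hpb
      (fun _ => rfl) (fun _ => rfl) μ y b z
  have h1q : |A1 * q| ≤ Ja * |q| :=
    (abs_tipWeight_mul_symLinCountAt_le hLc hrr (ψ := fun u => hpa (blk Lc u)) hpa (fun _ => rfl) μ y b z).trans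
      (mul_le_mul_of_nonneg_right (by rw [hhpa]; exact abs_hplus_jump_le Ga na μ y) (abs_nonneg _))
  have hB1q : |B1 * q| ≤ Jb * |q| :=
    (abs_dz_mul_symLinCountAt_le hLc hrr (ψ := fun u => hpb (blk Lc u)) hpb (fun _ => rfl) μ y b z).trans
      (mul_le_mul_of_nonneg_right (by rw [hhpb]; exact abs_hplus_jump_le Gb nb μ y) (abs_nonneg _))
  rw [e, h11, add_zero]
  calc |A0 * B0 * q + A0 * (B1 * q) + B0 * (A1 * q)|
      ≤ |A0 * B0 * q| + |A0 * (B1 * q)| + |B0 * (A1 * q)| := abs_add_three _ _ _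
    _ = |A0| * |B0| * |q| + |A0| * |B1 * q| + |B0| * |A1 * q| := by
        have e1 : |A0 * B0 * q| = |A0| * |B0| * |q| := by rw [abs_mul, abs_mul]
        rw [e1, abs_mul A0 (B1 * q), abs_mul B0 (A1 * q)]
    _ ≤ |A0| * |B0| * |q| + |A0| * (Jb * |q|) + |B0| * (Ja * |q|) := by gcongr
    _ = (|A0| * (|B0| + Jb) + Ja * |B0|) * |q| := by ring

/-- NOT IN PRINT; OUR BOOKKEEPING.  **THE ROOT WEIGHT OF ONE STAIRCASE TIMES THE GRADIENT OF ANOTHER, ON THE SUPPORT OF `q¹,ρ`**: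
`|(ψ_a(Lc·y+ρ) − ψ_a z)·(ψ_b(z+e_b) − ψ_b z)·count| ≤ (|G_a 0 (Lc·y+ρ) − G_a 0 z|·(|G_b 0 (z+e_b) − G_b 0 z| + J_b) + J_a·|G_b 0 (z+e_b) − G_b 0 z|)·|count|`. -/
theorem abs_rootWeight_mul_dz_staircase_mul_symLinCountAt_le (hLc : 1 ≤ Lc) (hrr : rr ∈ box (d + 1) Lc) (Ga Gb : ℕ → Site (d + 1) → ℝ) (na nb : ℕ)
    {ψa ψb : Site (d + 1) → ℝ} (hψa : ∀ u, ψa u = ∑ s ∈ Finset.range (na + 1), Ga s (blk (Lc ^ s) u))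
    (hψb : ∀ u, ψb u = ∑ s ∈ Finset.range (nb + 1), Gb s (blk (Lc ^ s) u))
    (μ : Fin (d + 1)) (y : Site (d + 1)) (b : Fin (d + 1)) (z : Site (d + 1)) :
    |(ψa ((Lc : ℤ) • y + toSite rr) - ψa z) * (ψb (z + unitVec b) - ψb z) * (symLinCountAt (toSite rr) Lc μ y (b, z) : ℝ)|
      ≤ (|Ga 0 ((Lc : ℤ) • y + toSite rr) - Ga 0 z|
            * (|Gb 0 (z + unitVec b) - Gb 0 z| + ∑ s ∈ Finset.range nb, |Gb (s + 1) (blk (Lc ^ s) (y + unitVec μ)) - Gb (s + 1) (blk (Lc ^ s) y)|)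
          + (∑ s ∈ Finset.range na, |Ga (s + 1) (blk (Lc ^ s) (y + unitVec μ)) - Ga (s + 1) (blk (Lc ^ s) y)|) * |Gb 0 (z + unitVec b) - Gb 0 z|)
        * |(symLinCountAt (toSite rr) Lc μ y (b, z) : ℝ)| := by
  set q : ℝ := (symLinCountAt (toSite rr) Lc μ y (b, z) : ℝ) with hq
  set hpa : Site (d + 1) → ℝ := fun y' => ∑ s ∈ Finset.range na, Ga (s + 1) (blk (Lc ^ s) y') with hhpa
  set hpb : Site (d + 1) → ℝ := fun y' => ∑ s ∈ Finset.range nb, Gb (s + 1) (blk (Lc ^ s) y') with hhpb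
  have hψa' : ∀ u, ψa u = Ga 0 u + hpa (blk Lc u) := fun u => by rw [hψa, staircase_split]
  have hψb' : ∀ u, ψb u = Gb 0 u + hpb (blk Lc u) := fun u => by rw [hψb, staircase_split]
  set A0 : ℝ := Ga 0 ((Lc : ℤ) • y + toSite rr) - Ga 0 z with hA0
  set A1 : ℝ := hpa (blk Lc ((Lc : ℤ) • y + toSite rr)) - hpa (blk Lc z) with hA1
  set B0 : ℝ := Gb 0 (z + unitVec b) - Gb 0 z with hB0
  set B1 : ℝ := hpb (blk Lc (z + unitVec b)) - hpb (blk Lc z) with hB1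
  set Ja : ℝ := ∑ s ∈ Finset.range na, |Ga (s + 1) (blk (Lc ^ s) (y + unitVec μ)) - Ga (s + 1) (blk (Lc ^ s) y)| with hJa
  set Jb : ℝ := ∑ s ∈ Finset.range nb, |Gb (s + 1) (blk (Lc ^ s) (y + unitVec μ)) - Gb (s + 1) (blk (Lc ^ s) y)| with hJb
  have e : (ψa ((Lc : ℤ) • y + toSite rr) - ψa z) * (ψb (z + unitVec b) - ψb z) * q
      = A0 * B0 * q + A0 * (B1 * q) + B0 * (A1 * q) + A1 * B1 * q := by
    simp only [hψa', hψb', hA0, hA1, hB0, hB1]; ring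
  have h11 : A1 * B1 * q = 0 :=
    rootWeight_mul_dz_mul_symLinCountAt_eq_zero hLc hrr (ψa := fun u => hpa (blk Lc u)) (ψb := fun u => hpb (blk Lc u)) hpa hpb
      (fun _ => rfl) (fun _ => rfl) μ y b z
  have h1q : |A1 * q| ≤ Ja * |q| :=
    (abs_rootWeight_mul_symLinCountAt_le hLc hrr (ψ := fun u => hpa (blk Lc u)) hpa (fun _ => rfl) μ y b z).trans
      (mul_le_mul_of_nonneg_right (by rw [hhpa]; exact abs_hplus_jump_le Ga na μ y) (abs_nonneg _))
  have hB1q : |B1 * q| ≤ Jb * |q| :=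
    (abs_dz_mul_symLinCountAt_le hLc hrr (ψ := fun u => hpb (blk Lc u)) hpb (fun _ => rfl) μ y b z).trans
      (mul_le_mul_of_nonneg_right (by rw [hhpb]; exact abs_hplus_jump_le Gb nb μ y) (abs_nonneg _))
  rw [e, h11, add_zero]
  calc |A0 * B0 * q + A0 * (B1 * q) + B0 * (A1 * q)|
      ≤ |A0 * B0 * q| + |A0 * (B1 * q)| + |B0 * (A1 * q)| := abs_add_three _ _ _
    _ = |A0| * |B0| * |q| + |A0| * |B1 * q| + |B0| * |A1 * q| := by
        have e1 : |A0 * B0 * q| = |A0| * |B0| * |q| := by rw [abs_mul, abs_mul]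
        rw [e1, abs_mul A0 (B1 * q), abs_mul B0 (A1 * q)]
    _ ≤ |A0| * |B0| * |q| + |A0| * (Jb * |q|) + |B0| * (Ja * |q|) := by gcongr
    _ = (|A0| * (|B0| + Jb) + Ja * |B0|) * |q| := by ring

end Pointwise

/-! ## §2 Commutator level: the tip and root two-site commutators against the gradient of a second staircase -/

section Commutator

variable {Lc : ℕ} {rr : Fin (d + 1) → ℕ}

/-- NOT IN PRINT; OUR BOOKKEEPING.  **THE TIP COMMUTATOR AGAINST A GRADIENT LEG** (one step, box root; finest letters `|G_a 0 (x+e_α) − G_a 0 (Lc·y+ρ+Lc·e_μ)| ≤ W_a` and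
`|dz (G_b 0) α x| ≤ g_b` on `nearBox Lc y`):
`|symLinAvgAt ρ (fun α x ↦ ψ_a(x+e_α)·dz ψ_b α x) Lc μ y − ψ_a(Lc·y+ρ+Lc·e_μ)·symLinAvgAt ρ (dz ψ_b) Lc μ y| ≤ (W_a·(g_b + J_b(μ,y)) + J_a(μ,y)·g_b)·Σ_{x∈nearBox} Σ_α |count(α,x)|`. -/
theorem abs_tipCommutator_dz_le_of_staircase_of_le (hLc : 1 ≤ Lc) (hrr : rr ∈ box (d + 1) Lc) (Ga Gb : ℕ → Site (d + 1) → ℝ) (na nb : ℕ)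
    {ψa ψb : Site (d + 1) → ℝ} (hψa : ∀ u, ψa u = ∑ s ∈ Finset.range (na + 1), Ga s (blk (Lc ^ s) u))
    (hψb : ∀ u, ψb u = ∑ s ∈ Finset.range (nb + 1), Gb s (blk (Lc ^ s) u)) (μ : Fin (d + 1)) (y : Site (d + 1))
    {Wa gb : ℝ} (hWa0 : 0 ≤ Wa)
    (hWa : ∀ α, ∀ x ∈ nearBox Lc y, |Ga 0 (x + unitVec α) - Ga 0 ((Lc : ℤ) • y + toSite rr + (Lc : ℤ) • unitVec μ)| ≤ Wa)
    (hgb : ∀ α, ∀ x ∈ nearBox Lc y, |dz (Gb 0) α x| ≤ gb) :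
    |symLinAvgAt (toSite rr) (fun α x => ψa (x + unitVec α) * dz ψb α x) Lc μ y
        - ψa ((Lc : ℤ) • y + toSite rr + (Lc : ℤ) • unitVec μ) * symLinAvgAt (toSite rr) (dz ψb) Lc μ y|
      ≤ (Wa * (gb + ∑ s ∈ Finset.range nb, |Gb (s + 1) (blk (Lc ^ s) (y + unitVec μ)) - Gb (s + 1) (blk (Lc ^ s) y)|)
            + (∑ s ∈ Finset.range na, |Ga (s + 1) (blk (Lc ^ s) (y + unitVec μ)) - Ga (s + 1) (blk (Lc ^ s) y)|) * gb)
          * ∑ x ∈ nearBox Lc y, ∑ α, |(symLinCountAt (toSite rr) Lc μ y (α, x) : ℝ)| := by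
  rw [tipCommutator_eq_sum hrr, Finset.mul_sum]
  refine (Finset.abs_sum_le_sum_abs _ _).trans (Finset.sum_le_sum fun x hx => ?_)
  rw [Finset.mul_sum]
  refine (Finset.abs_sum_le_sum_abs _ _).trans (Finset.sum_le_sum fun α _ => ?_)
  have h := abs_tipWeight_mul_dz_staircase_mul_symLinCountAt_le hLc hrr Ga Gb na nb hψa hψb μ y α x
  have e : (ψa (x + unitVec α) - ψa ((Lc : ℤ) • y + toSite rr + (Lc : ℤ) • unitVec μ)) * (symLinCountAt (toSite rr) Lc μ y (α, x) : ℝ) * dz ψb α x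
      = (ψa (x + unitVec α) - ψa ((Lc : ℤ) • y + toSite rr + (Lc : ℤ) • unitVec μ)) * (ψb (x + unitVec α) - ψb x)
          * (symLinCountAt (toSite rr) Lc μ y (α, x) : ℝ) := by
    simp only [dz]; ring
  rw [e]
  refine h.trans ?_
  have hJa : 0 ≤ ∑ s ∈ Finset.range na, |Ga (s + 1) (blk (Lc ^ s) (y + unitVec μ)) - Ga (s + 1) (blk (Lc ^ s) y)| :=
    Finset.sum_nonneg fun _ _ => abs_nonneg _
  have hJb : 0 ≤ ∑ s ∈ Finset.range nb, |Gb (s + 1) (blk (Lc ^ s) (y + unitVec μ)) - Gb (s + 1) (blk (Lc ^ s) y)| :=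
    Finset.sum_nonneg fun _ _ => abs_nonneg _
  have h1 := hWa α x hx
  have h2 := hgb α x hx
  simp only [dz] at h2
  have h0 := abs_nonneg (Ga 0 (x + unitVec α) - Ga 0 ((Lc : ℤ) • y + toSite rr + (Lc : ℤ) • unitVec μ))
  have h0' := abs_nonneg (Gb 0 (x + unitVec α) - Gb 0 x)
  exact mul_le_mul_of_nonneg_right (by gcongr) (abs_nonneg _)

/-- NOT IN PRINT; OUR BOOKKEEPING.  **THE ROOT COMMUTATOR AGAINST A GRADIENT LEG** (one step, box root; `|G_a 0 (Lc·y+ρ) − G_a 0 x| ≤ W_a`, `|dz (G_b 0) α x| ≤ g_b` on `nearBox Lc y`):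
`|ψ_a(Lc·y+ρ)·symLinAvgAt ρ (dz ψ_b) Lc μ y − symLinAvgAt ρ (fun α x ↦ ψ_a x·dz ψ_b α x) Lc μ y| ≤ (W_a·(g_b + J_b(μ,y)) + J_a(μ,y)·g_b)·Σ_{x∈nearBox} Σ_α |count(α,x)|`. -/
theorem abs_rootCommutator_dz_le_of_staircase_of_le (hLc : 1 ≤ Lc) (hrr : rr ∈ box (d + 1) Lc) (Ga Gb : ℕ → Site (d + 1) → ℝ) (na nb : ℕ)
    {ψa ψb : Site (d + 1) → ℝ} (hψa : ∀ u, ψa u = ∑ s ∈ Finset.range (na + 1), Ga s (blk (Lc ^ s) u))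
    (hψb : ∀ u, ψb u = ∑ s ∈ Finset.range (nb + 1), Gb s (blk (Lc ^ s) u)) (μ : Fin (d + 1)) (y : Site (d + 1))
    {Wa gb : ℝ} (hWa0 : 0 ≤ Wa)
    (hWa : ∀ x ∈ nearBox Lc y, |Ga 0 ((Lc : ℤ) • y + toSite rr) - Ga 0 x| ≤ Wa)
    (hgb : ∀ α, ∀ x ∈ nearBox Lc y, |dz (Gb 0) α x| ≤ gb) :
    |ψa ((Lc : ℤ) • y + toSite rr) * symLinAvgAt (toSite rr) (dz ψb) Lc μ y
        - symLinAvgAt (toSite rr) (fun α x => ψa x * dz ψb α x) Lc μ y|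
      ≤ (Wa * (gb + ∑ s ∈ Finset.range nb, |Gb (s + 1) (blk (Lc ^ s) (y + unitVec μ)) - Gb (s + 1) (blk (Lc ^ s) y)|)
            + (∑ s ∈ Finset.range na, |Ga (s + 1) (blk (Lc ^ s) (y + unitVec μ)) - Ga (s + 1) (blk (Lc ^ s) y)|) * gb)
          * ∑ x ∈ nearBox Lc y, ∑ α, |(symLinCountAt (toSite rr) Lc μ y (α, x) : ℝ)| := by
  rw [rootCommutator_eq_sum hrr, Finset.mul_sum]
  refine (Finset.abs_sum_le_sum_abs _ _).trans (Finset.sum_le_sum fun x hx => ?_)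
  rw [Finset.mul_sum]
  refine (Finset.abs_sum_le_sum_abs _ _).trans (Finset.sum_le_sum fun α _ => ?_)
  have h := abs_rootWeight_mul_dz_staircase_mul_symLinCountAt_le hLc hrr Ga Gb na nb hψa hψb μ y α x
  have e : (ψa ((Lc : ℤ) • y + toSite rr) - ψa x) * (symLinCountAt (toSite rr) Lc μ y (α, x) : ℝ) * dz ψb α x
      = (ψa ((Lc : ℤ) • y + toSite rr) - ψa x) * (ψb (x + unitVec α) - ψb x) * (symLinCountAt (toSite rr) Lc μ y (α, x) : ℝ) := by
    simp only [dz]; ring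
  rw [e]
  refine h.trans ?_
  have hJa : 0 ≤ ∑ s ∈ Finset.range na, |Ga (s + 1) (blk (Lc ^ s) (y + unitVec μ)) - Ga (s + 1) (blk (Lc ^ s) y)| :=
    Finset.sum_nonneg fun _ _ => abs_nonneg _
  have hJb : 0 ≤ ∑ s ∈ Finset.range nb, |Gb (s + 1) (blk (Lc ^ s) (y + unitVec μ)) - Gb (s + 1) (blk (Lc ^ s) y)| :=
    Finset.sum_nonneg fun _ _ => abs_nonneg _
  have h1 := hWa x hx
  have h2 := hgb α x hx
  simp only [dz] at h2
  have h0 := abs_nonneg (Ga 0 ((Lc : ℤ) • y + toSite rr) - Ga 0 x)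
  have h0' := abs_nonneg (Gb 0 (x + unitVec α) - Gb 0 x)
  exact mul_le_mul_of_nonneg_right (by gcongr) (abs_nonneg _)

end Commutator

/-! ## §3 Envelope forms (leaf-02's PART 1 §3 pattern: the envelopes of the letters factored out) -/

section Envelope

variable {Lc : ℕ} {rr : Fin (d + 1) → ℕ}

/-- NOT IN PRINT; OUR BOOKKEEPING ([folklore] over leaf-01's `abs_tipCommutator_le_of_staircase_of_le`).  **THE TIP COMMUTATOR LETTER, ENVELOPE FORM**: finest-piece tip weight
`≤ W₀·E` on the support box, jumps `≤ F·E` (ONE envelope value `E ≥ 0` of the bond), a leg `|T α x| ≤ M` on the support box, count `≤ Cnt` ⇒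
`|symLinAvgAt ρ (ψ⁺•T) Lc μ y − ψ(far)·symLinAvgAt ρ T Lc μ y| ≤ (W₀ + F)·(E·M·Cnt)`. -/
theorem abs_tipCommutator_le_of_staircase_of_env (hLc : 1 ≤ Lc) (hrr : rr ∈ box (d + 1) Lc) (G : ℕ → Site (d + 1) → ℝ) (n : ℕ)
    {ψ : Site (d + 1) → ℝ} (hψ : ∀ u, ψ u = ∑ s ∈ Finset.range (n + 1), G s (blk (Lc ^ s) u)) (T : Form1 (d + 1) ℝ) (μ : Fin (d + 1)) (y : Site (d + 1))
    {W₀ F E M Cnt : ℝ} (hW₀ : 0 ≤ W₀) (hE : 0 ≤ E) (hM : 0 ≤ M)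
    (hW : ∀ α, ∀ x ∈ nearBox Lc y, |G 0 (x + unitVec α) - G 0 ((Lc : ℤ) • y + toSite rr + (Lc : ℤ) • unitVec μ)| ≤ W₀ * E)
    (hJ : ∑ s ∈ Finset.range n, |G (s + 1) (blk (Lc ^ s) (y + unitVec μ)) - G (s + 1) (blk (Lc ^ s) y)| ≤ F * E)
    (hT : ∀ α, ∀ x ∈ nearBox Lc y, |T α x| ≤ M)
    (hCnt : ∑ x ∈ nearBox Lc y, ∑ α, |(symLinCountAt (toSite rr) Lc μ y (α, x) : ℝ)| ≤ Cnt) :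
    |symLinAvgAt (toSite rr) (fun α x => ψ (x + unitVec α) * T α x) Lc μ y
        - ψ ((Lc : ℤ) • y + toSite rr + (Lc : ℤ) • unitVec μ) * symLinAvgAt (toSite rr) T Lc μ y|
      ≤ (W₀ + F) * (E * M * Cnt) := by
  have h := abs_tipCommutator_le_of_staircase_of_le hLc hrr G n hψ T μ y hW hT
  have hJ0 : 0 ≤ ∑ s ∈ Finset.range n, |G (s + 1) (blk (Lc ^ s) (y + unitVec μ)) - G (s + 1) (blk (Lc ^ s) y)| :=
    Finset.sum_nonneg fun _ _ => abs_nonneg _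
  have hc0 : 0 ≤ ∑ x ∈ nearBox Lc y, ∑ α, |(symLinCountAt (toSite rr) Lc μ y (α, x) : ℝ)| :=
    Finset.sum_nonneg fun _ _ => Finset.sum_nonneg fun _ _ => abs_nonneg _
  have hWE : 0 ≤ W₀ * E := mul_nonneg hW₀ hE
  refine h.trans ?_
  calc (W₀ * E + ∑ s ∈ Finset.range n, |G (s + 1) (blk (Lc ^ s) (y + unitVec μ)) - G (s + 1) (blk (Lc ^ s) y)|) * M
          * ∑ x ∈ nearBox Lc y, ∑ α, |(symLinCountAt (toSite rr) Lc μ y (α, x) : ℝ)|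
        ≤ (W₀ * E + F * E) * M * Cnt := by
          have h1 : (W₀ * E + ∑ s ∈ Finset.range n, |G (s + 1) (blk (Lc ^ s) (y + unitVec μ)) - G (s + 1) (blk (Lc ^ s) y)|) * M
              ≤ (W₀ * E + F * E) * M := mul_le_mul_of_nonneg_right (by linarith) hM
          exact mul_le_mul h1 hCnt hc0 (mul_nonneg (by linarith) hM)
    _ = (W₀ + F) * (E * M * Cnt) := by ring

/-- NOT IN PRINT; OUR BOOKKEEPING ([folklore] over leaf-01's `abs_rootCommutator_le_of_staircase_of_le`).  **THE ROOT COMMUTATOR LETTER, ENVELOPE FORM**: finest-piece root weight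
`|G 0 (Lc·y+ρ) − G 0 x| ≤ W₀·E`, jumps `≤ F·E`, leg `≤ M`, count `≤ Cnt` ⇒ `|ψ(root)·symLinAvgAt ρ T Lc μ y − symLinAvgAt ρ (ψ•T) Lc μ y| ≤ (W₀ + F)·(E·M·Cnt)`. -/
theorem abs_rootCommutator_le_of_staircase_of_env (hLc : 1 ≤ Lc) (hrr : rr ∈ box (d + 1) Lc) (G : ℕ → Site (d + 1) → ℝ) (n : ℕ)
    {ψ : Site (d + 1) → ℝ} (hψ : ∀ u, ψ u = ∑ s ∈ Finset.range (n + 1), G s (blk (Lc ^ s) u)) (T : Form1 (d + 1) ℝ) (μ : Fin (d + 1)) (y : Site (d + 1))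
    {W₀ F E M Cnt : ℝ} (hW₀ : 0 ≤ W₀) (hE : 0 ≤ E) (hM : 0 ≤ M)
    (hW : ∀ x ∈ nearBox Lc y, |G 0 ((Lc : ℤ) • y + toSite rr) - G 0 x| ≤ W₀ * E)
    (hJ : ∑ s ∈ Finset.range n, |G (s + 1) (blk (Lc ^ s) (y + unitVec μ)) - G (s + 1) (blk (Lc ^ s) y)| ≤ F * E)
    (hT : ∀ α, ∀ x ∈ nearBox Lc y, |T α x| ≤ M)
    (hCnt : ∑ x ∈ nearBox Lc y, ∑ α, |(symLinCountAt (toSite rr) Lc μ y (α, x) : ℝ)| ≤ Cnt) :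
    |ψ ((Lc : ℤ) • y + toSite rr) * symLinAvgAt (toSite rr) T Lc μ y - symLinAvgAt (toSite rr) (fun α x => ψ x * T α x) Lc μ y|
      ≤ (W₀ + F) * (E * M * Cnt) := by
  have h := abs_rootCommutator_le_of_staircase_of_le hLc hrr G n hψ T μ y hW hT
  have hJ0 : 0 ≤ ∑ s ∈ Finset.range n, |G (s + 1) (blk (Lc ^ s) (y + unitVec μ)) - G (s + 1) (blk (Lc ^ s) y)| :=
    Finset.sum_nonneg fun _ _ => abs_nonneg _
  have hc0 : 0 ≤ ∑ x ∈ nearBox Lc y, ∑ α, |(symLinCountAt (toSite rr) Lc μ y (α, x) : ℝ)| :=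
    Finset.sum_nonneg fun _ _ => Finset.sum_nonneg fun _ _ => abs_nonneg _
  have hWE : 0 ≤ W₀ * E := mul_nonneg hW₀ hE
  refine h.trans ?_
  calc (W₀ * E + ∑ s ∈ Finset.range n, |G (s + 1) (blk (Lc ^ s) (y + unitVec μ)) - G (s + 1) (blk (Lc ^ s) y)|) * M
          * ∑ x ∈ nearBox Lc y, ∑ α, |(symLinCountAt (toSite rr) Lc μ y (α, x) : ℝ)|
        ≤ (W₀ * E + F * E) * M * Cnt := by
          have h1 : (W₀ * E + ∑ s ∈ Finset.range n, |G (s + 1) (blk (Lc ^ s) (y + unitVec μ)) - G (s + 1) (blk (Lc ^ s) y)|) * M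
              ≤ (W₀ * E + F * E) * M := mul_le_mul_of_nonneg_right (by linarith) hM
          exact mul_le_mul h1 hCnt hc0 (mul_nonneg (by linarith) hM)
    _ = (W₀ + F) * (E * M * Cnt) := by ring

/-- NOT IN PRINT; OUR BOOKKEEPING ([folklore]).  **THE TIP × GRADIENT LETTER, ENVELOPE FORM** (two staircases of the same depth class with a COMMON jump letter `F`): finest tip weight of
`ψ_a` `≤ W_a·E_a`, finest gradient of `ψ_b` `≤ g_b·E_b` on the support box, jumps `J_a ≤ F·E_a`, `J_b ≤ F·E_b` (`E_a, E_b ≥ 0`), count `≤ Cnt`: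
`|[tip commutator of ψ_a](dz ψ_b)(μ,y)| ≤ (W_a·g_b + (W_a + g_b)·F)·(E_a·E_b·Cnt)` — the two coarse jump sums never multiply. -/
theorem abs_tipCommutator_dz_le_of_staircase_of_env (hLc : 1 ≤ Lc) (hrr : rr ∈ box (d + 1) Lc) (Ga Gb : ℕ → Site (d + 1) → ℝ) (n : ℕ)
    {ψa ψb : Site (d + 1) → ℝ} (hψa : ∀ u, ψa u = ∑ s ∈ Finset.range (n + 1), Ga s (blk (Lc ^ s) u))
    (hψb : ∀ u, ψb u = ∑ s ∈ Finset.range (n + 1), Gb s (blk (Lc ^ s) u)) (μ : Fin (d + 1)) (y : Site (d + 1))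
    {Wa gb F Ea Eb Cnt : ℝ} (hWa0 : 0 ≤ Wa) (hgb0 : 0 ≤ gb) (hEa : 0 ≤ Ea) (hEb : 0 ≤ Eb)
    (hWa : ∀ α, ∀ x ∈ nearBox Lc y, |Ga 0 (x + unitVec α) - Ga 0 ((Lc : ℤ) • y + toSite rr + (Lc : ℤ) • unitVec μ)| ≤ Wa * Ea)
    (hgb : ∀ α, ∀ x ∈ nearBox Lc y, |dz (Gb 0) α x| ≤ gb * Eb)
    (hJa : ∑ s ∈ Finset.range n, |Ga (s + 1) (blk (Lc ^ s) (y + unitVec μ)) - Ga (s + 1) (blk (Lc ^ s) y)| ≤ F * Ea)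
    (hJb : ∑ s ∈ Finset.range n, |Gb (s + 1) (blk (Lc ^ s) (y + unitVec μ)) - Gb (s + 1) (blk (Lc ^ s) y)| ≤ F * Eb)
    (hCnt : ∑ x ∈ nearBox Lc y, ∑ α, |(symLinCountAt (toSite rr) Lc μ y (α, x) : ℝ)| ≤ Cnt) :
    |symLinAvgAt (toSite rr) (fun α x => ψa (x + unitVec α) * dz ψb α x) Lc μ y
        - ψa ((Lc : ℤ) • y + toSite rr + (Lc : ℤ) • unitVec μ) * symLinAvgAt (toSite rr) (dz ψb) Lc μ y|
      ≤ (Wa * gb + (Wa + gb) * F) * (Ea * Eb * Cnt) := by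
  have h := abs_tipCommutator_dz_le_of_staircase_of_le hLc hrr Ga Gb n n hψa hψb μ y (mul_nonneg hWa0 hEa) hWa hgb
  set Ja : ℝ := ∑ s ∈ Finset.range n, |Ga (s + 1) (blk (Lc ^ s) (y + unitVec μ)) - Ga (s + 1) (blk (Lc ^ s) y)| with hJadef
  set Jb : ℝ := ∑ s ∈ Finset.range n, |Gb (s + 1) (blk (Lc ^ s) (y + unitVec μ)) - Gb (s + 1) (blk (Lc ^ s) y)| with hJbdef
  have hJa0 : 0 ≤ Ja := Finset.sum_nonneg fun _ _ => abs_nonneg _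
  have hJb0 : 0 ≤ Jb := Finset.sum_nonneg fun _ _ => abs_nonneg _
  have hc0 : 0 ≤ ∑ x ∈ nearBox Lc y, ∑ α, |(symLinCountAt (toSite rr) Lc μ y (α, x) : ℝ)| :=
    Finset.sum_nonneg fun _ _ => Finset.sum_nonneg fun _ _ => abs_nonneg _
  refine h.trans ?_
  have hpre : Wa * Ea * (gb * Eb + Jb) + Ja * (gb * Eb) ≤ (Wa * gb + (Wa + gb) * F) * (Ea * Eb) := by
    have h1 : Wa * Ea * Jb ≤ Wa * Ea * (F * Eb) := mul_le_mul_of_nonneg_left hJb (mul_nonneg hWa0 hEa)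
    have h2 : Ja * (gb * Eb) ≤ (F * Ea) * (gb * Eb) := mul_le_mul_of_nonneg_right hJa (mul_nonneg hgb0 hEb)
    nlinarith
  have hpre0 : 0 ≤ Wa * Ea * (gb * Eb + Jb) + Ja * (gb * Eb) := by positivity
  calc (Wa * Ea * (gb * Eb + Jb) + Ja * (gb * Eb)) * ∑ x ∈ nearBox Lc y, ∑ α, |(symLinCountAt (toSite rr) Lc μ y (α, x) : ℝ)|
      ≤ ((Wa * gb + (Wa + gb) * F) * (Ea * Eb)) * Cnt := mul_le_mul hpre hCnt hc0 (hpre0.trans hpre)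
    _ = (Wa * gb + (Wa + gb) * F) * (Ea * Eb * Cnt) := by ring

/-- NOT IN PRINT; OUR BOOKKEEPING ([folklore]).  **THE ROOT × GRADIENT LETTER, ENVELOPE FORM**: finest root weight of `ψ_a` `≤ W_a·E_a`, finest gradient of `ψ_b` `≤ g_b·E_b`, jumps
`J_a ≤ F·E_a`, `J_b ≤ F·E_b`, count `≤ Cnt` ⇒ `|[root commutator of ψ_a](dz ψ_b)(μ,y)| ≤ (W_a·g_b + (W_a + g_b)·F)·(E_a·E_b·Cnt)`. -/
theorem abs_rootCommutator_dz_le_of_staircase_of_env (hLc : 1 ≤ Lc) (hrr : rr ∈ box (d + 1) Lc) (Ga Gb : ℕ → Site (d + 1) → ℝ) (n : ℕ)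
    {ψa ψb : Site (d + 1) → ℝ} (hψa : ∀ u, ψa u = ∑ s ∈ Finset.range (n + 1), Ga s (blk (Lc ^ s) u))
    (hψb : ∀ u, ψb u = ∑ s ∈ Finset.range (n + 1), Gb s (blk (Lc ^ s) u)) (μ : Fin (d + 1)) (y : Site (d + 1))
    {Wa gb F Ea Eb Cnt : ℝ} (hWa0 : 0 ≤ Wa) (hgb0 : 0 ≤ gb) (hEa : 0 ≤ Ea) (hEb : 0 ≤ Eb)
    (hWa : ∀ x ∈ nearBox Lc y, |Ga 0 ((Lc : ℤ) • y + toSite rr) - Ga 0 x| ≤ Wa * Ea)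
    (hgb : ∀ α, ∀ x ∈ nearBox Lc y, |dz (Gb 0) α x| ≤ gb * Eb)
    (hJa : ∑ s ∈ Finset.range n, |Ga (s + 1) (blk (Lc ^ s) (y + unitVec μ)) - Ga (s + 1) (blk (Lc ^ s) y)| ≤ F * Ea)
    (hJb : ∑ s ∈ Finset.range n, |Gb (s + 1) (blk (Lc ^ s) (y + unitVec μ)) - Gb (s + 1) (blk (Lc ^ s) y)| ≤ F * Eb)
    (hCnt : ∑ x ∈ nearBox Lc y, ∑ α, |(symLinCountAt (toSite rr) Lc μ y (α, x) : ℝ)| ≤ Cnt) :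
    |ψa ((Lc : ℤ) • y + toSite rr) * symLinAvgAt (toSite rr) (dz ψb) Lc μ y
        - symLinAvgAt (toSite rr) (fun α x => ψa x * dz ψb α x) Lc μ y|
      ≤ (Wa * gb + (Wa + gb) * F) * (Ea * Eb * Cnt) := by
  have h := abs_rootCommutator_dz_le_of_staircase_of_le hLc hrr Ga Gb n n hψa hψb μ y (mul_nonneg hWa0 hEa) hWa hgb
  set Ja : ℝ := ∑ s ∈ Finset.range n, |Ga (s + 1) (blk (Lc ^ s) (y + unitVec μ)) - Ga (s + 1) (blk (Lc ^ s) y)| with hJadef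
  set Jb : ℝ := ∑ s ∈ Finset.range n, |Gb (s + 1) (blk (Lc ^ s) (y + unitVec μ)) - Gb (s + 1) (blk (Lc ^ s) y)| with hJbdef
  have hJa0 : 0 ≤ Ja := Finset.sum_nonneg fun _ _ => abs_nonneg _
  have hJb0 : 0 ≤ Jb := Finset.sum_nonneg fun _ _ => abs_nonneg _
  have hc0 : 0 ≤ ∑ x ∈ nearBox Lc y, ∑ α, |(symLinCountAt (toSite rr) Lc μ y (α, x) : ℝ)| :=
    Finset.sum_nonneg fun _ _ => Finset.sum_nonneg fun _ _ => abs_nonneg _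
  refine h.trans ?_
  have hpre : Wa * Ea * (gb * Eb + Jb) + Ja * (gb * Eb) ≤ (Wa * gb + (Wa + gb) * F) * (Ea * Eb) := by
    have h1 : Wa * Ea * Jb ≤ Wa * Ea * (F * Eb) := mul_le_mul_of_nonneg_left hJb (mul_nonneg hWa0 hEa)
    have h2 : Ja * (gb * Eb) ≤ (F * Ea) * (gb * Eb) := mul_le_mul_of_nonneg_right hJa (mul_nonneg hgb0 hEb)
    nlinarith
  have hpre0 : 0 ≤ Wa * Ea * (gb * Eb + Jb) + Ja * (gb * Eb) := by positivity
  calc (Wa * Ea * (gb * Eb + Jb) + Ja * (gb * Eb)) * ∑ x ∈ nearBox Lc y, ∑ α, |(symLinCountAt (toSite rr) Lc μ y (α, x) : ℝ)|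
      ≤ ((Wa * gb + (Wa + gb) * F) * (Ea * Eb)) * Cnt := mul_le_mul hpre hCnt hc0 (hpre0.trans hpre)
    _ = (Wa * gb + (Wa + gb) * F) * (Ea * Eb * Cnt) := by ring

end Envelope

end Summit.QuantumFields.BalabanUV.Beta.GAN24.SymContactBorderCellLetters

end
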